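import Literature.NumberTheory.Weil1964.AdelicMetaplecticRationalLiftSum
import HarnessLib

/-!
# Weil's rational lift of a Levi PERMUTATION acts on `𝒮(𝔸_Fⁿ)` by the coordinate permutation — with character factor `1`
# ([Weil1964] Chap. I n° 13, Chap. III n° 41 Thm 6)

Topic `NumberTheory/Weil1964`; namespace `Literature.NumberTheory.Weil1964`.  KERNEL MATHEMATICS ONLY (theorems; no definition, no
named fact, no proof hole).  For a rational Levi element `m(γ) ∈ Sp_{2n}(F)` whose matrix `γ ∈ GL_n(F)` is a PERMUTATION MATRIX
`P_σ = σ.permMatrix F` (`σ : Equiv.Perm (Fin n)`; `(P_σ)_{ij} = [σ i = j]`):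

* `map_permMatrix`, `permMatrix_inv_eq_transpose`, **`coe_trInv_ratGL_of_eq_permMatrix`** — `(γ_𝔸⁻¹)ᵀ = P_σ` over the adeles
  (a permutation matrix is orthogonal);
* **`coe_omega_ratThetaLiftCont_levi_perm`** — THE LEVI CHARACTER FACTOR IS `1`: Weil's `Θ`-fixing lift acts by
  `ω(r_F(m(γ))) Φ (x) = Φ(x · (γ⁻¹)ᵀ) = Φ(x · P_σ) = Φ(x ∘ σ⁻¹)` (★ `coe_ratThetaLiftCont_levi`: `r_F(m(γ)) = leviPair (γ_𝔸)`,
  ★ `coe_toOp_leviPair`: the operator is the pure twist `Φ ↦ Φ(· (γ⁻¹)ᵀ)`, NO `|det|^{1/2}` (`= 1` on rational points) and NO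
  character — any `χ(det)` of a Weil representation of a unitary group lives in its splitting, not in `r_F`); in particular at
  `det P_σ = sign σ = ±1` nothing is carried;
* **`omega_ratThetaLiftCont_levi_perm_sumTensor`** — hence `r_F(m(P_σ))` RE-LABELS THE COORDINATE SPLITTING OF PURE TENSORS:
  `ω(r_F(m(P_σ))) (Φ₁ ⊠_e Φ₂) = Φ₁ ⊠_{σ ≫ e} Φ₂` for every splitting `e : Fin n ≃ κ₁ ⊕ κ₂` (★ `coe_sumTensor_apply`) — the shuffle
  that turns `⊠_{idxSplitD}` into `⊠_{e₂}` (or any other enumeration) once the permutation is chosen.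

Consumer: the model identification #42N of the rank-two doubling method ([Liu2021, App. B]; tree socket U6), road (N″) «by the see-saw
permutation» (LEAD F0P6 M-155k (9), piece (P2)): `sD_V(δ′) = r_F(ι δ′)` for the rational permutation `δ′` swapping the two `−t₀` blocks.

## References
* [Weil1964] A. Weil, Sur certains groupes d'opérateurs unitaires, Acta Math. 111 (1964), Chap. I n° 13 p. 160 (`r(m(a))Φ = Φ ∘ aᵀ`-type
  formula for the Levi factor), Chap. III n° 41 Thm 6 p. 193 (`r_F`).
* [MoeglinVignerasWaldspurger1987] LNM 1291, Chap. 2 II.2, II.6.  [Kudla1994] S. S. Kudla, Israel J. Math. 87 (1994), §2.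
-/

set_option autoImplicit false

noncomputable section

open NumberField
open scoped Matrix

namespace Literature.NumberTheory.Weil1964

open Literature.RepresentationTheory.HeisenbergGroup Literature.NumberTheory.Automorphic

/-! ## §1 Permutation matrices: base change, inverse, transpose-inverse -/

section PermMatrix

variable {R S : Type*} [CommRing R] [CommRing S] {m : Type*} [Fintype m] [DecidableEq m] (σ : Equiv.Perm m)

omit [Fintype m] in
/-- a permutation matrix is preserved by every ring map applied entrywise. [cite: Weil1964, Chap. I n° 13 p. 160] -/
theorem map_permMatrix (f : R →+* S) : (σ.permMatrix R).map f = σ.permMatrix S := by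
  ext i j
  simp only [Matrix.map_apply, Equiv.Perm.permMatrix, PEquiv.toMatrix_apply, Equiv.toPEquiv_apply, Option.mem_def,
    Option.some.injEq]
  split_ifs <;> simp

/-- a permutation matrix is orthogonal: `P_σ⁻¹ = P_σᵀ`. [cite: Weil1964, Chap. I n° 13 p. 160] -/
theorem permMatrix_inv_eq_transpose : (σ.permMatrix R)⁻¹ = (σ.permMatrix R)ᵀ := by
  rw [Matrix.transpose_permMatrix]
  refine Matrix.inv_eq_left_inv ?_
  rw [← Matrix.permMatrix_mul, mul_inv_cancel, Matrix.permMatrix_one]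

end PermMatrix

section Rational

variable (F : Type) [Field F] [NumberField F] {n : ℕ}
variable (T : Matrix (Fin n) (Fin n) (AdeleRing (𝓞 F) F)) (hT : IsUnit T.det)

/-- **the transpose-inverse of a rational permutation matrix, read over the adeles, is itself**: `((P_σ)_𝔸⁻¹)ᵀ = P_σ`.
[cite: Weil1964, Chap. I n° 13 p. 160] -/
theorem coe_trInv_ratGL_of_eq_permMatrix (γ : GL (Fin n) F) (σ : Equiv.Perm (Fin n))
    (hγ : (γ : Matrix (Fin n) (Fin n) F) = σ.permMatrix F) :
    ((trInv (ratGL F γ) : GL (Fin n) (AdeleRing (𝓞 F) F)) : Matrix (Fin n) (Fin n) (AdeleRing (𝓞 F) F)) =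
      σ.permMatrix (AdeleRing (𝓞 F) F) := by
  have h1 : ((ratGL F γ : GL (Fin n) (AdeleRing (𝓞 F) F)) : Matrix (Fin n) (Fin n) (AdeleRing (𝓞 F) F)) =
      σ.permMatrix (AdeleRing (𝓞 F) F) := by
    change (γ : Matrix (Fin n) (Fin n) F).map (algebraMap F (AdeleRing (𝓞 F) F)) = _
    rw [hγ, map_permMatrix]
  change (((ratGL F γ)⁻¹ : GL (Fin n) (AdeleRing (𝓞 F) F)) : Matrix (Fin n) (Fin n) (AdeleRing (𝓞 F) F))ᵀ = _
  rw [Matrix.coe_units_inv, h1, permMatrix_inv_eq_transpose, Matrix.transpose_transpose]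

include hT in
/-- **THE LEVI CHARACTER FACTOR IS `1`**: for a rational Levi element whose matrix is the permutation matrix `P_σ`, Weil's `Θ`-fixing lift
acts on `𝒮(𝔸_Fⁿ)` by the bare coordinate permutation `(ω(r_F(m(P_σ))) Φ)(x) = Φ(x ∘ σ⁻¹)` — no modulus, no character
(★ `coe_ratThetaLiftCont_levi`, ★ `coe_toOp_leviPair`, `x · P_σ = x ∘ σ⁻¹`). [cite: Weil1964, Chap. I n° 13 p. 160 and Chap. III n° 41 Thm 6 p. 193] -/
theorem coe_omega_ratThetaLiftCont_levi_perm (γ : GL (Fin n) F) (σ : Equiv.Perm (Fin n))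
    (hγ : (γ : Matrix (Fin n) (Fin n) F) = σ.permMatrix F) (Φ : piSchwartzBruhat F (Fin n)) :
    ((adelicMpCont.omega F (Fin n) T (ratThetaLiftCont F T hT (SymplecticMatrix.levi γ)) Φ : piSchwartzBruhat F (Fin n)) :
        (Fin n → AdeleRing (𝓞 F) F) → ℂ) =
      fun x => (Φ : (Fin n → AdeleRing (𝓞 F) F) → ℂ) fun j => x (σ.symm j) := by
  have h1 : ((MpPsi.toOp (adelicSchrodinger F (Fin n) T)
      (ratThetaLiftCont F T hT (SymplecticMatrix.levi γ) : adelicMp F (Fin n) T) Φ : piSchwartzBruhat F (Fin n)) :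
        (Fin n → AdeleRing (𝓞 F) F) → ℂ) = twist F (trInv (ratGL F γ)) (Φ : (Fin n → AdeleRing (𝓞 F) F) → ℂ) :=
    (congrArg (fun q : adelicMp F (Fin n) T =>
      ((MpPsi.toOp (adelicSchrodinger F (Fin n) T) q Φ : piSchwartzBruhat F (Fin n)) : (Fin n → AdeleRing (𝓞 F) F) → ℂ))
      (coe_ratThetaLiftCont_levi F T hT γ)).trans (coe_toOp_leviPair F T hT (ratGL F γ) Φ)
  change ((MpPsi.toOp (adelicSchrodinger F (Fin n) T)
      (ratThetaLiftCont F T hT (SymplecticMatrix.levi γ) : adelicMp F (Fin n) T) Φ : piSchwartzBruhat F (Fin n)) :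
        (Fin n → AdeleRing (𝓞 F) F) → ℂ) = _
  refine h1.trans (funext fun x => ?_)
  rw [twist_apply, coe_trInv_ratGL_of_eq_permMatrix F γ σ hγ, Matrix.vecMul_permMatrix]
  rfl

include hT in
/-- **a rational Levi permutation RE-LABELS THE COORDINATE SPLITTING of pure tensors**:
`ω(r_F(m(P_σ))) (Φ₁ ⊠_e Φ₂) = Φ₁ ⊠_{σ ≫ e} Φ₂` for every splitting `e : Fin n ≃ κ₁ ⊕ κ₂` (★ `coe_sumTensor_apply`).
[cite: Weil1964, Chap. I n° 13 p. 160 and Chap. III n° 38 pp. 189–190] [cite: Kudla1994, §2] -/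
theorem omega_ratThetaLiftCont_levi_perm_sumTensor {κ₁ κ₂ : Type} [Fintype κ₁] [Fintype κ₂] (e : Fin n ≃ κ₁ ⊕ κ₂)
    (γ : GL (Fin n) F) (σ : Equiv.Perm (Fin n)) (hγ : (γ : Matrix (Fin n) (Fin n) F) = σ.permMatrix F)
    (Φ₁ : piSchwartzBruhat F κ₁) (Φ₂ : piSchwartzBruhat F κ₂) :
    adelicMpCont.omega F (Fin n) T (ratThetaLiftCont F T hT (SymplecticMatrix.levi γ)) (sumTensor F e Φ₁ Φ₂) =
      sumTensor F (σ.trans e) Φ₁ Φ₂ := by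
  apply Subtype.ext
  refine (coe_omega_ratThetaLiftCont_levi_perm F T hT γ σ hγ (sumTensor F e Φ₁ Φ₂)).trans (funext fun x => ?_)
  rw [coe_sumTensor_apply, coe_sumTensor_apply]
  rfl

include hT in
/-- the same read pointwise. [cite: Weil1964, Chap. I n° 13 p. 160 and Chap. III n° 38 pp. 189–190] -/
theorem coe_omega_ratThetaLiftCont_levi_perm_sumTensor_apply {κ₁ κ₂ : Type} [Fintype κ₁] [Fintype κ₂]
    (e : Fin n ≃ κ₁ ⊕ κ₂) (γ : GL (Fin n) F) (σ : Equiv.Perm (Fin n)) (hγ : (γ : Matrix (Fin n) (Fin n) F) = σ.permMatrix F)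
    (Φ₁ : piSchwartzBruhat F κ₁) (Φ₂ : piSchwartzBruhat F κ₂) (x : Fin n → AdeleRing (𝓞 F) F) :
    ((adelicMpCont.omega F (Fin n) T (ratThetaLiftCont F T hT (SymplecticMatrix.levi γ)) (sumTensor F e Φ₁ Φ₂) : piSchwartzBruhat F (Fin n)) :
        (Fin n → AdeleRing (𝓞 F) F) → ℂ) x =
      (Φ₁ : (κ₁ → AdeleRing (𝓞 F) F) → ℂ) (fun i => x (σ.symm (e.symm (Sum.inl i)))) *
        (Φ₂ : (κ₂ → AdeleRing (𝓞 F) F) → ℂ) (fun k => x (σ.symm (e.symm (Sum.inr k)))) :=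
  (congrFun (congrArg (fun Ψ : piSchwartzBruhat F (Fin n) => ((Ψ : (Fin n → AdeleRing (𝓞 F) F) → ℂ)))
    (omega_ratThetaLiftCont_levi_perm_sumTensor F T hT e γ σ hγ Φ₁ Φ₂)) x).trans (coe_sumTensor_apply F (σ.trans e) Φ₁ Φ₂ x)

end Rational

end Literature.NumberTheory.Weil1964

end
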